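import Summits.Langlands.Langlands.Theorems.PhantomRMYoshidaResiduallyYoshidaLiftingRamifiedClassTameRelation
import Summits.Langlands.Langlands.Theorems.PhantomRMYoshidaResiduallyYoshidaLiftingCrossRatioOfTameEigen
import HarnessLib

/-!
# Selmer classes are UNRAMIFIED OFF THE CROSS-RATIO PLACES (stub `stub_selmerClassUnramifiedOffCross`, LR3) —
# line `sector-klingen-split`, crux `ResiduallyYoshidaLifting` (stmt-Langlands-13639)

Lead prover-line-stmt-Langlands-13639-c5-0 (continuation c5, cycle 4, skeleton rev 16c, 2026-08-17).

Assembly of the landed LR `Fibre.stub_ramifiedClassTameRelation` (p171801: for `τ ∈ I_v`, `σ̄(φ) B(τ) = q_v · B(τ) σ̄'(φ)`) and LR2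
`Fibre.stub_crossRatioOfTameEigen` (p171699: `S X = q X S'` with `X ≠ 0` forces a cross ratio of eigenvalues): at a place `v ∤ p` where
`σ̄, σ̄'` are unramified and no cross ratio `α = q_v β` holds between the eigenvalues of `σ̄(φ)` and `σ̄'(φ)` (`φ` a Frobenius element),
every locally constant `Hom(σ̄', σ̄)`-cocycle vanishes on `I_v`.  No new definitions, no named fact taken as a hypothesis.
-/

noncomputable section

-- `Summit.Langlands.Langlands.…` (summit = sub-problem name, D-0017 layout) trips `dupNamespace` on every decl.
set_option linter.dupNamespace false
set_option autoImplicit false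

open IsDedekindDomain Filter
open scoped Matrix
open Literature.NumberTheory.GaloisRepresentations Literature.NumberTheory.Automorphic

namespace Summit.Langlands.Langlands.Cruxes.ResiduallyYoshidaLifting.SectorKlingenSplit.Fibre

/-- **Registered sub-goal LR3 `stub_selmerClassUnramifiedOffCross`** (skeleton rev 16c): at `v ∤ p` with `σ̄, σ̄'` unramified and NO cross
ratio `α = q_v β` between the eigenvalues of `σ̄(φ)` and `σ̄'(φ)` for a Frobenius element `φ`, every locally constant `Hom(σ̄', σ̄)`-cocycle —
in particular every Greenberg–Selmer class — is UNRAMIFIED at `v` (vanishes on `I_v`): the auxiliary ramification of the fibre is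
supported on the ×-type level-raising places of line C.  (LR gives `σ̄(φ) B(τ) = q_v B(τ) σ̄'(φ)`; if `B(τ) ≠ 0`, LR2 gives the excluded
cross ratio.) [folklore] -/
theorem stub_selmerClassUnramifiedOffCross :
    ∀ (p : ℕ) [Fact p.Prime] (k : Type) [Field k] [CharP k p] [IsAlgClosed k] [TopologicalSpace k] [DiscreteTopology k]
      (σ σ' : FramedGaloisRep ℚ k 2) (B : Field.absoluteGaloisGroup ℚ → Matrix (Fin 2) (Fin 2) k)
      (v : HeightOneSpectrum (NumberField.RingOfIntegers ℚ)),
      ((p : ℕ) : NumberField.RingOfIntegers ℚ) ∉ v.asIdeal →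
      (∀ g g', B (g * g') = (σ g).val * B g' + B g * (σ' g').val) → IsLocallyConstant B →
      (∀ τ ∈ absInertia (v.adicCompletion ℚ),
        σ (absGaloisRestrict ℚ (v.adicCompletion ℚ) τ) = 1 ∧ σ' (absGaloisRestrict ℚ (v.adicCompletion ℚ) τ) = 1) →
      ∀ φ : Field.absoluteGaloisGroup (v.adicCompletion ℚ), IsFrobPow φ 1 →
      (¬ ∃ α β : k, (σ (absGaloisRestrict ℚ (v.adicCompletion ℚ) φ)).val.charpoly.IsRoot α ∧
          (σ' (absGaloisRestrict ℚ (v.adicCompletion ℚ) φ)).val.charpoly.IsRoot β ∧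
          α = (IsNonarchimedeanLocalField.residueFieldCard (v.adicCompletion ℚ) : k) * β) →
      ∀ τ ∈ absInertia (v.adicCompletion ℚ), B (absGaloisRestrict ℚ (v.adicCompletion ℚ) τ) = 0 := by
  intro p _ k _ _ _ _ _ σ σ' B v hv hcoc hlc hunr φ hφ hno τ hτ
  by_contra hne
  have hrel := stub_ramifiedClassTameRelation p k σ σ' B v hv hcoc hlc hunr φ hφ τ hτ
  exact hno (stub_crossRatioOfTameEigen k _ _ _ _ hne hrel)

end Summit.Langlands.Langlands.Cruxes.ResiduallyYoshidaLifting.SectorKlingenSplit.Fibre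

end
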